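import Summits.ValiantsHypothesis.ValiantsHypothesis.Theorems.LacunarySymmetroidMatrixDescartesCensusReflect

/-!
# `MatrixDescartes` census — reflective certificates, Part 2: LIST-based, CHUNKABLE rows

HONEST FRAMING.  Verification infrastructure for the finite census of real symmetric lacunary pencils (cells
`pub-symmetroid`, `val-V1-extremal`); companion of `…CensusReflect` (Part 1: `certCheck`, `idet`, `evalAt`, `signAt`,
`not_posRootLawAt_of_certCheck`).  Nothing here bears on the asymptotic crux `Theses.LacunarySymmetroid.MatrixDescartes`
(stmt-ValiantsHypothesis-18050) nor on `VP ≠ VNP`.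

WHY.  A Part-1 row evaluates every test point's exact determinant sign twice and must sit in ONE file; rows with
`m ≥ 6`, thousands of digits and 60–120 points can exceed one gate node's elaboration budget (observed: a 6×6,
1958-digit, 60-point row — 292 s on one farm node, bounced on another).  Here each sign is computed ONCE (`signsL`)
and the conclusion is LOCALISED to an open interval: a chunk `lo :: mid ++ [hi]` of positive, strictly increasing
rational points with strictly alternating exact signs certifies `mid.length + 1` distinct roots in `(lo, hi)`
(`le_card_Ioo_of_chunkCheck`, intermediate value theorem along a `List.IsChain`); chunks sharing their junction point
glue (`card_filter_Ioo_add_le`), and `not_posRootLawAt_of_le_card_Ioo` turns the total into `¬ PosRootLawAt m K B`.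
So a big row = several files `chunkCheck … = true` (`decide +kernel` each, any size budget) + one tiny assembling file
(`not_posRootLawAt_of_chunkCheck₂/₃` or the general lemmas).

[folklore] Elementary (intermediate value theorem; finite-set counting); proof by reflection.
-/

-- `Summit.ValiantsHypothesis.ValiantsHypothesis.…` repeats a component by the D-0017 layout
-- (single-conjunct summit), which the `dupNamespace` linter flags; the name is mandated.
set_option linter.dupNamespace false

namespace Summit.ValiantsHypothesis.ValiantsHypothesis.Theorems.LacunarySymmetroidMatrixDescartes.Census.Reflect

open Summit.ValiantsHypothesis.ValiantsHypothesis.Theorems.MatrixDescartes.Negative (PosRootLawAt)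
open scoped BigOperators Matrix


/-- Exact signs at a list of rational points `(a, b) ↦ a/b` (each computed once). [folklore] -/
def signsL (m K D : ℕ) (d : Fin K → ℕ) (S : Fin K → Fin m → Fin m → ℤ) : List (ℕ × ℕ) → List ℤ
  | [] => []
  | p :: ps => signAt m K D d S p.1 p.2 :: signsL m K D d S ps

/-- Consecutive signs multiply to `−1`. [folklore] -/
def altL : List ℤ → Bool
  | [] => true
  | [_] => true
  | x :: y :: rest => (x * y == -1) && altL (y :: rest)

/-- All points positive (`0 < a`, `0 < b`) and strictly increasing (`a/b < a'/b'` as `a b' < a' b`). [folklore] -/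
def monoL : List (ℕ × ℕ) → Bool
  | [] => true
  | [p] => decide (0 < p.1) && decide (0 < p.2)
  | p :: q :: rest => decide (0 < p.1) && (decide (0 < p.2) && (decide (p.1 * q.2 < q.1 * p.2) && monoL (q :: rest)))

/-- Symmetric letters, Boolean form. [folklore] -/
def symmB (m K : ℕ) (S : Fin K → Fin m → Fin m → ℤ) : Bool :=
  finAll K (fun l => finAll m (fun i => finAll m (fun j => S l i j == S l j i)))

/-- **Chunk check** on the points `lo :: mid ++ [hi]`: positive, strictly increasing, exact determinant signs alternating.
(Symmetry is checked once, separately, by `symmB`.) [folklore] -/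
def chunkCheck (m K : ℕ) (d : Fin K → ℕ) (S : Fin K → Fin m → Fin m → ℤ) (lo : ℕ × ℕ) (mid : List (ℕ × ℕ))
    (hi : ℕ × ℕ) : Bool :=
  monoL (lo :: (mid ++ [hi])) && altL (signsL m K (finMax K d) d S (lo :: (mid ++ [hi])))

/-- The rational point `a/b` as a real number. [folklore] -/
noncomputable def ptR (p : ℕ × ℕ) : ℝ := (p.1 : ℝ) / (p.2 : ℝ)

/-- The real determinant polynomial of the integer letter family `S` on the support `d`. [folklore] -/
noncomputable def pencilPolyZ (m K : ℕ) (d : Fin K → ℕ) (S : Fin K → Fin m → Fin m → ℤ) : Polynomial ℝ :=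
  (∑ l, (Polynomial.X : Polynomial ℝ) ^ d l • (Matrix.of fun i j => (S l i j : ℝ)).map Polynomial.C).det

/-- an alternating chain `x, mid…, y` (consecutive points increasing with opposite signs of `f`) is increasing end
to end. [folklore] -/
theorem chain_lt {f : ℝ → ℝ} : ∀ (x : ℝ) (mid : List ℝ) (y : ℝ),
    List.IsChain (fun u v => u < v ∧ f u * f v < 0) (x :: (mid ++ [y])) → x < y
  | x, [], y, h => by
    rw [List.nil_append, List.isChain_cons_cons] at h
    exact h.1.1
  | x, z :: rest, y, h => by
    rw [List.cons_append, List.isChain_cons_cons] at h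
    exact h.1.1.trans (chain_lt z rest y h.2)

/-- **Localised IVT count**: an alternating chain `x, mid…, y` of a polynomial gives `mid.length + 1` distinct roots in
the open interval `(x, y)`. [folklore] -/
theorem le_card_filter_of_chain (p : Polynomial ℝ) :
    ∀ (x : ℝ) (mid : List ℝ) (y : ℝ),
      List.IsChain (fun u v => u < v ∧ p.eval u * p.eval v < 0) (x :: (mid ++ [y])) →
      mid.length + 1 ≤ (p.roots.toFinset.filter (fun t => x < t ∧ t < y)).card := by
  -- one root strictly between two points of opposite sign
  have ivt : ∀ u v : ℝ, u < v → p.eval u * p.eval v < 0 → ∃ r, u < r ∧ r < v ∧ p.IsRoot r := by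
    intro u v huv h
    have hcont : ContinuousOn (fun x => p.eval x) (Set.Icc u v) := p.continuous.continuousOn
    rcases mul_neg_iff.1 h with ⟨h1, h2⟩ | ⟨h1, h2⟩
    · obtain ⟨r, ⟨hr1, hr2⟩, hr⟩ := intermediate_value_Ioo' huv.le hcont ⟨h2, h1⟩
      exact ⟨r, hr1, hr2, hr⟩
    · obtain ⟨r, ⟨hr1, hr2⟩, hr⟩ := intermediate_value_Ioo huv.le hcont ⟨h1, h2⟩
      exact ⟨r, hr1, hr2, hr⟩
  have hp0 : ∀ u v : ℝ, p.eval u * p.eval v < 0 → p ≠ 0 := by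
    rintro u v h rfl
    simp at h
  intro x mid
  induction mid generalizing x with
  | nil =>
    intro y h
    rw [List.nil_append, List.isChain_cons_cons] at h
    obtain ⟨r, hr1, hr2, hr⟩ := ivt x y h.1.1 h.1.2
    have hmem : r ∈ p.roots.toFinset.filter (fun t => x < t ∧ t < y) := by
      simp only [Finset.mem_filter, Multiset.mem_toFinset, Polynomial.mem_roots (hp0 x y h.1.2)]
      exact ⟨hr, hr1, hr2⟩
    simpa using Finset.card_pos.mpr ⟨r, hmem⟩
  | cons z rest ih =>
    intro y h
    rw [List.cons_append, List.isChain_cons_cons] at h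
    obtain ⟨⟨hxz, hsz⟩, hrest⟩ := h
    have hzy : z < y := chain_lt z rest y hrest
    obtain ⟨r, hr1, hr2, hr⟩ := ivt x z hxz hsz
    have hIH := ih z y hrest
    have hsub : insert r (p.roots.toFinset.filter (fun t => z < t ∧ t < y))
        ⊆ p.roots.toFinset.filter (fun t => x < t ∧ t < y) := by
      intro t ht
      rcases Finset.mem_insert.mp ht with rfl | ht
      · simp only [Finset.mem_filter, Multiset.mem_toFinset, Polynomial.mem_roots (hp0 x z hsz)]
        exact ⟨hr, hr1, hr2.trans hzy⟩
      · simp only [Finset.mem_filter] at ht ⊢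
        exact ⟨ht.1, hxz.trans ht.2.1, ht.2.2⟩
    have hnot : r ∉ p.roots.toFinset.filter (fun t => z < t ∧ t < y) := by
      intro hm
      simp only [Finset.mem_filter] at hm
      exact lt_irrefl _ (hr2.trans hm.2.1)
    calc (z :: rest).length + 1 = (rest.length + 1) + 1 := by simp
      _ ≤ (p.roots.toFinset.filter (fun t => z < t ∧ t < y)).card + 1 := Nat.add_le_add_right hIH 1
      _ = (insert r (p.roots.toFinset.filter (fun t => z < t ∧ t < y))).card :=
          (Finset.card_insert_of_notMem hnot).symm
      _ ≤ _ := Finset.card_le_card hsub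

/-- **Gluing**: roots in `(a,b)` and in `(b,c)` are distinct roots in `(a,c)` (`a ≤ b ≤ c`). [folklore] -/
theorem card_filter_Ioo_add_le (s : Finset ℝ) {a b c : ℝ} (hab : a ≤ b) (hbc : b ≤ c) :
    (s.filter (fun t => a < t ∧ t < b)).card + (s.filter (fun t => b < t ∧ t < c)).card
      ≤ (s.filter (fun t => a < t ∧ t < c)).card := by
  rw [← Finset.card_union_of_disjoint]
  · refine Finset.card_le_card (fun t ht => ?_)
    simp only [Finset.mem_union, Finset.mem_filter] at ht ⊢
    rcases ht with ⟨hs, h1, h2⟩ | ⟨hs, h1, h2⟩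
    · exact ⟨hs, h1, lt_of_lt_of_le h2 hbc⟩
    · exact ⟨hs, lt_of_le_of_lt hab h1, h2⟩
  · rw [Finset.disjoint_left]
    intro t h1 h2
    simp only [Finset.mem_filter] at h1 h2
    exact lt_irrefl _ (h1.2.2.trans h2.2.1)

/-- evaluation of `pencilPolyZ` at a real point is the real pencil determinant. [folklore] -/
theorem eval_pencilPolyZ (m K : ℕ) (d : Fin K → ℕ) (S : Fin K → Fin m → Fin m → ℤ) (t : ℝ) :
    (pencilPolyZ m K d S).eval t = (∑ l, t ^ d l • (Matrix.of fun i j => (S l i j : ℝ))).det := by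
  unfold pencilPolyZ
  rw [Summit.ValiantsHypothesis.ValiantsHypothesis.Theorems.SymmetroidDescartes.eval_det_pencil]

/-- two consecutive certified signs ⇒ the determinant values have opposite signs. [folklore] -/
theorem eval_mul_eval_neg {m K : ℕ} (d : Fin K → ℕ) (S : Fin K → Fin m → Fin m → ℤ) {p q : ℕ × ℕ}
    (hp : 0 < p.2) (hq : 0 < q.2)
    (hs : signAt m K (finMax K d) d S p.1 p.2 * signAt m K (finMax K d) d S q.1 q.2 = -1) :
    (pencilPolyZ m K d S).eval (ptR p) * (pencilPolyZ m K d S).eval (ptR q) < 0 := by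
  rw [eval_pencilPolyZ, eval_pencilPolyZ]
  have hD : ∀ l, d l ≤ finMax K d := le_finMax d
  have hpR : (0 : ℝ) < p.2 := by exact_mod_cast hp
  have hqR : (0 : ℝ) < q.2 := by exact_mod_cast hq
  have kp := det_evalAt d hD S p.1 p.2 (ne_of_gt hpR)
  have kq := det_evalAt d hD S q.1 q.2 (ne_of_gt hqR)
  have hneg := mul_neg_of_sign hs
  rw [← kp, ← kq] at hneg
  have hc : (0 : ℝ) < ((p.2 : ℝ) ^ finMax K d) ^ m * ((q.2 : ℝ) ^ finMax K d) ^ m :=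
    mul_pos (pow_pos (pow_pos hpR _) _) (pow_pos (pow_pos hqR _) _)
  have hprod : ((p.2 : ℝ) ^ finMax K d) ^ m * ((q.2 : ℝ) ^ finMax K d) ^ m
      * ((∑ l, ptR p ^ d l • (Matrix.of fun i j => (S l i j : ℝ))).det
        * (∑ l, ptR q ^ d l • (Matrix.of fun i j => (S l i j : ℝ))).det) < 0 := by
    unfold ptR
    calc ((p.2 : ℝ) ^ finMax K d) ^ m * ((q.2 : ℝ) ^ finMax K d) ^ m
          * ((∑ l, ((p.1 : ℝ) / (p.2 : ℝ)) ^ d l • (Matrix.of fun i j => (S l i j : ℝ))).det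
            * (∑ l, ((q.1 : ℝ) / (q.2 : ℝ)) ^ d l • (Matrix.of fun i j => (S l i j : ℝ))).det)
        = (((p.2 : ℝ) ^ finMax K d) ^ m
            * (∑ l, ((p.1 : ℝ) / (p.2 : ℝ)) ^ d l • (Matrix.of fun i j => (S l i j : ℝ))).det)
          * ((((q.2 : ℝ) ^ finMax K d) ^ m)
            * (∑ l, ((q.1 : ℝ) / (q.2 : ℝ)) ^ d l • (Matrix.of fun i j => (S l i j : ℝ))).det) := by ring
      _ < 0 := hneg
  exact lt_of_not_ge (fun hge => absurd hprod (not_lt.mpr (mul_nonneg hc.le hge)))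

/-- Boolean chunk ⇒ real alternating chain. [folklore] -/
theorem chain_of_chunk {m K : ℕ} (d : Fin K → ℕ) (S : Fin K → Fin m → Fin m → ℤ) :
    ∀ (lo : ℕ × ℕ) (mid : List (ℕ × ℕ)) (hi : ℕ × ℕ),
      monoL (lo :: (mid ++ [hi])) = true →
      altL (signsL m K (finMax K d) d S (lo :: (mid ++ [hi]))) = true →
      List.IsChain (fun u v => u < v ∧ (pencilPolyZ m K d S).eval u * (pencilPolyZ m K d S).eval v < 0)
        (ptR lo :: (mid.map ptR ++ [ptR hi])) := by
  intro lo mid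
  induction mid generalizing lo with
  | nil =>
    intro hi hmono halt
    simp only [List.nil_append, monoL, signsL, altL, Bool.and_eq_true, decide_eq_true_eq,
      beq_iff_eq] at hmono halt
    obtain ⟨_, hlo2, hlt, _, hhi2⟩ := hmono
    rw [List.map_nil, List.nil_append, List.isChain_cons_cons]
    refine ⟨⟨?_, eval_mul_eval_neg d S hlo2 hhi2 halt.1⟩, List.isChain_singleton _⟩
    unfold ptR
    rw [div_lt_div_iff₀ (by exact_mod_cast hlo2) (by exact_mod_cast hhi2)]
    exact_mod_cast hlt
  | cons z rest ih =>
    intro hi hmono halt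
    rw [List.cons_append] at hmono halt
    have hmono' : decide (0 < lo.1) = true ∧ decide (0 < lo.2) = true ∧
        decide (lo.1 * z.2 < z.1 * lo.2) = true ∧ monoL (z :: (rest ++ [hi])) = true := by
      simpa only [monoL, Bool.and_eq_true] using hmono
    have halt' : (signAt m K (finMax K d) d S lo.1 lo.2 * signAt m K (finMax K d) d S z.1 z.2 == -1) = true ∧
        altL (signsL m K (finMax K d) d S (z :: (rest ++ [hi]))) = true := by
      simpa only [signsL, altL, Bool.and_eq_true] using halt
    obtain ⟨_, hlo2, hlt, hrest⟩ := hmono'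
    have hz2 : 0 < z.2 := by
      cases rest with
      | nil =>
        simp only [List.nil_append, monoL, Bool.and_eq_true, decide_eq_true_eq] at hrest
        exact hrest.2.1
      | cons w rest' =>
        rw [List.cons_append] at hrest
        simp only [monoL, Bool.and_eq_true, decide_eq_true_eq] at hrest
        exact hrest.2.1
    rw [decide_eq_true_eq] at hlo2 hlt
    rw [List.map_cons, List.cons_append, List.isChain_cons_cons]
    refine ⟨⟨?_, eval_mul_eval_neg d S hlo2 hz2 (by simpa using halt'.1)⟩, ih z hi hrest halt'.2⟩
    unfold ptR
    rw [div_lt_div_iff₀ (by exact_mod_cast hlo2) (by exact_mod_cast hz2)]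
    exact_mod_cast hlt

/-- **Chunk ⇒ localised root count**: `chunkCheck m K d S lo mid hi = true` gives `mid.length + 1` distinct roots of the
pencil determinant in the open interval `(lo, hi)`. [folklore] -/
theorem le_card_Ioo_of_chunkCheck {m K : ℕ} {d : Fin K → ℕ} {S : Fin K → Fin m → Fin m → ℤ}
    {lo : ℕ × ℕ} {mid : List (ℕ × ℕ)} {hi : ℕ × ℕ} (h : chunkCheck m K d S lo mid hi = true) :
    mid.length + 1 ≤ ((pencilPolyZ m K d S).roots.toFinset.filter (fun t => ptR lo < t ∧ t < ptR hi)).card := by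
  simp only [chunkCheck, Bool.and_eq_true] at h
  have hc := chain_of_chunk d S lo mid hi h.1 h.2
  simpa using le_card_filter_of_chain (pencilPolyZ m K d S) (ptR lo) (mid.map ptR) (ptR hi) hc

/-- a certified chunk's ends are ordered: `lo < hi`. [folklore] -/
theorem ptR_lt_of_chunkCheck {m K : ℕ} {d : Fin K → ℕ} {S : Fin K → Fin m → Fin m → ℤ}
    {lo : ℕ × ℕ} {mid : List (ℕ × ℕ)} {hi : ℕ × ℕ} (h : chunkCheck m K d S lo mid hi = true) :
    ptR lo < ptR hi := by
  simp only [chunkCheck, Bool.and_eq_true] at h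
  exact chain_lt _ _ _ (chain_of_chunk d S lo mid hi h.1 h.2)

/-- a certified chunk starts at a positive point. [folklore] -/
theorem ptR_pos_of_chunkCheck {m K : ℕ} {d : Fin K → ℕ} {S : Fin K → Fin m → Fin m → ℤ}
    {lo : ℕ × ℕ} {mid : List (ℕ × ℕ)} {hi : ℕ × ℕ} (h : chunkCheck m K d S lo mid hi = true) :
    0 < ptR lo := by
  simp only [chunkCheck, Bool.and_eq_true] at h
  have hmono := h.1
  have : decide (0 < lo.1) = true ∧ decide (0 < lo.2) = true := by
    cases mid with
    | nil => simp only [List.nil_append, monoL, Bool.and_eq_true] at hmono; exact ⟨hmono.1, hmono.2.1⟩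
    | cons z rest =>
      rw [List.cons_append] at hmono
      simp only [monoL, Bool.and_eq_true] at hmono; exact ⟨hmono.1, hmono.2.1⟩
  rw [decide_eq_true_eq, decide_eq_true_eq] at this
  exact div_pos (by exact_mod_cast this.1) (by exact_mod_cast this.2)

/-- **Localised count ⇒ row**: `N` roots in some `(lo, hi)` with `0 ≤ lo` and symmetric letters give
`¬ PosRootLawAt m K B` for every `B < N`. [folklore] -/
theorem not_posRootLawAt_of_le_card_Ioo {m K N B : ℕ} {d : Fin K → ℕ} {S : Fin K → Fin m → Fin m → ℤ}
    (hS : symmB m K S = true) {lo hi : ℝ} (hlo : 0 ≤ lo)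
    (hN : N ≤ ((pencilPolyZ m K d S).roots.toFinset.filter (fun t => lo < t ∧ t < hi)).card) (hB : B < N) :
    ¬ PosRootLawAt m K B := by
  intro hlaw
  have hsym : ∀ l i j, S l i j = S l j i := fun l i j => by
    simpa using of_finAll (of_finAll (of_finAll hS l) i) j
  have hle := hlaw d (fun l => Matrix.of fun i j => (S l i j : ℝ)) (fun l => realLetters_isSymm hsym l)
  have hsub : (pencilPolyZ m K d S).roots.toFinset.filter (fun t => lo < t ∧ t < hi)
      ⊆ (pencilPolyZ m K d S).roots.toFinset.filter (fun t => 0 < t) := by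
    intro t ht
    simp only [Finset.mem_filter] at ht ⊢
    exact ⟨ht.1, lt_of_le_of_lt hlo ht.2.1⟩
  have := (hN.trans (Finset.card_le_card hsub)).trans hle
  omega

/-- One-chunk convenience form: a single `chunkCheck` plus `symmB` gives the row. [folklore] -/
theorem not_posRootLawAt_of_chunkCheck {m K B : ℕ} {d : Fin K → ℕ} {S : Fin K → Fin m → Fin m → ℤ}
    {lo : ℕ × ℕ} {mid : List (ℕ × ℕ)} {hi : ℕ × ℕ} (hS : symmB m K S = true)
    (h : chunkCheck m K d S lo mid hi = true) (hB : B < mid.length + 1) : ¬ PosRootLawAt m K B :=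
  not_posRootLawAt_of_le_card_Ioo hS (ptR_pos_of_chunkCheck h).le (le_card_Ioo_of_chunkCheck h) hB

/-- Two-chunk convenience form (chunks share the junction point `mi`). [folklore] -/
theorem not_posRootLawAt_of_chunkCheck₂ {m K B : ℕ} {d : Fin K → ℕ} {S : Fin K → Fin m → Fin m → ℤ}
    {lo mi hi : ℕ × ℕ} {mid₁ mid₂ : List (ℕ × ℕ)} (hS : symmB m K S = true)
    (h₁ : chunkCheck m K d S lo mid₁ mi = true) (h₂ : chunkCheck m K d S mi mid₂ hi = true)
    (hB : B < mid₁.length + 1 + (mid₂.length + 1)) : ¬ PosRootLawAt m K B :=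
  not_posRootLawAt_of_le_card_Ioo hS (ptR_pos_of_chunkCheck h₁).le
    ((Nat.add_le_add (le_card_Ioo_of_chunkCheck h₁) (le_card_Ioo_of_chunkCheck h₂)).trans
      (card_filter_Ioo_add_le _ (ptR_lt_of_chunkCheck h₁).le (ptR_lt_of_chunkCheck h₂).le)) hB

/-- Three-chunk convenience form. [folklore] -/
theorem not_posRootLawAt_of_chunkCheck₃ {m K B : ℕ} {d : Fin K → ℕ} {S : Fin K → Fin m → Fin m → ℤ}
    {p₀ p₁ p₂ p₃ : ℕ × ℕ} {mid₁ mid₂ mid₃ : List (ℕ × ℕ)} (hS : symmB m K S = true)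
    (h₁ : chunkCheck m K d S p₀ mid₁ p₁ = true) (h₂ : chunkCheck m K d S p₁ mid₂ p₂ = true)
    (h₃ : chunkCheck m K d S p₂ mid₃ p₃ = true)
    (hB : B < mid₁.length + 1 + (mid₂.length + 1) + (mid₃.length + 1)) : ¬ PosRootLawAt m K B := by
  have h12 := (Nat.add_le_add (le_card_Ioo_of_chunkCheck h₁) (le_card_Ioo_of_chunkCheck h₂)).trans
    (card_filter_Ioo_add_le _ (ptR_lt_of_chunkCheck h₁).le (ptR_lt_of_chunkCheck h₂).le)
  have h123 := (Nat.add_le_add h12 (le_card_Ioo_of_chunkCheck h₃)).trans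
    (card_filter_Ioo_add_le _ ((ptR_lt_of_chunkCheck h₁).trans (ptR_lt_of_chunkCheck h₂)).le
      (ptR_lt_of_chunkCheck h₃).le)
  exact not_posRootLawAt_of_le_card_Ioo hS (ptR_pos_of_chunkCheck h₁).le h123 hB

end Summit.ValiantsHypothesis.ValiantsHypothesis.Theorems.LacunarySymmetroidMatrixDescartes.Census.Reflect
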